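import Mathlib
import HarnessLib
import Literature.Analysis.FluidPDE.Tao2016AveragedNS.LocalCascadeSolutions
import Literature.Analysis.FluidPDE.Tao2016AveragedNS.RenormalisedCascadeWaves
import Literature.Analysis.FluidPDE.Tao2016AveragedNS.SelfSimilarCascadeBlowup
import Literature.Analysis.FluidPDE.Tao2016AveragedNS.ViscousEternalSolutions
import Literature.Analysis.FluidPDE.Tao2016AveragedNS.BoundedEternalSolutions
import Summits.NavierStokesRegularity.NavierStokesRegularity.Theses.TaoLadderRungTwoBreak
import Summits.NavierStokesRegularity.NavierStokesRegularity.Theorems.TaoLadderRungTwoBreakNoSurvivingEternalViscBddOneSmallActionRung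
import Summits.NavierStokesRegularity.NavierStokesRegularity.Theorems.TaoLadderRungTwoBreakNoSurvivingEternalViscBddOneWeightedGrowth
import Summits.NavierStokesRegularity.NavierStokesRegularity.Theorems.TaoLadderRungTwoBreakNoSurvivingEternalViscBddOneSurvivorEnergyBound

/-!
# The `1/ε₀` AMPLITUDE FLOOR OF BOUNDED SURVIVORS — crux K1ᵛ(1) `TaoLadderRungTwoBreak.NoSurvivingEternalViscBddOne` ⟨20419⟩
# (both split children (ρ0) ⟨20451⟩ / (ρ+) ⟨20452⟩): every uniformly bounded, forward-(S₁)-surviving admissible eternal solution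
# (any covariant viscosity `ν̂ ≥ 0`) of a cancelling table has `sup‖W‖ ≥ (4/7)·Λ/(C_A(Λ²−1)) ≈ 0.11/(C_A ε₀)`; hence K1ᵛ(1) HOLDS on
# every bounded-amplitude slice `{sup‖W‖ ≤ B}` with an explicit threshold `ε_s(B) ≍ 1/B`

MODEL lattice ODEs only (Tao 2016 §4, §6.4; cell vocabulary `IsEternalVisc`, `UniformBound`, `physEnergy`, `physFlux`,
`EternalSurvivingFwd`); nothing here is a statement about the Navier–Stokes equations; no stub, crux or summit is closed
(`--supports stmt-NavierStokesRegularity-20419`).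

THE MECHANISM (three kernel estimates, the first two in the companion file `…SurvivorEnergyBound`; the first one on this crux in which BOTH the smallness of `ε₀` and the lateness of the
surviving event are used).  Write `E_n = physEnergy`, `F_n = physFlux`, `Λ = bigLam ε₀`, `C_A = fluxConst α`, `‖W‖ ≤ B`.
* UNIFORM ENERGY BOUND (`exists_uniform_physEnergy_le`): `sup_{n ≥ 0, σ} E_n(σ) =: K < ∞` — the energy of the shells `n ≥ 0` is fed
  only through the bond `−1 → 0`, whose flux `|F₋₁| ≤ 2C_AΛ⁻¹ e^{−σ}√E₀·E₋₁` is INTEGRABLE forward (`energySum_le`; the interior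
  fluxes telescope, the dissipation has a sign, the top leak is sent to `N → ∞`).
* LATE FLUX STARVATION (`physEnergy_late_le`): `E_n(σ₂) ≤ E_n(σ₁) + 4C_AΛⁿK^{3/2}e^{−σ₁}` for `σ₁ ≤ σ₂`, `n ≥ 1` — in log-time the
  bond fluxes `|F_{n−1}|, |F_n| ≤ 2C_AΛⁿK^{3/2}e^{−σ}` die out (physical time runs out), so a shell cannot GAIN energy late.
* THE GROWTH LAW (tree `weightedSum_le`): `θⁿE_n(σ) ≤ (δ₀ + cAσ)e^{(θ−1)cσ}`, `c = 2C_AB/Λ`, `1 ≤ θ < Λ²` — the θ-weighted energy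
  climbs at rate `≤ (θ−1)c` in log-time, so the surviving level `E_n ≥ c₀(1+ε₀)^{−n}` is reached at shell `n` only AFTER
  `σ_m(n) ≈ n·log(θ/(1+ε₀))/((θ−1)c)`.
Starvation from `σ_m(n)` on then needs `e^{σ_m(n)} ≲ Λⁿ(1+ε₀)ⁿ = e^{3.5·n·log(1+ε₀)}`; letting `θ ↑ Λ² = (1+ε₀)⁵` the two are
compatible for large `n` only if `4·log(1+ε₀) ≤ 3.5·log(1+ε₀)·(Λ²−1)·2C_AB/Λ`, i.e.

  **`4Λ ≤ 7·C_A·B·(Λ² − 1)`** (`survivor_amplitude_floor`) — the general-survivor analogue (factor `4/7`) of the tree's DSS floor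
  `Λ ≤ C_A·B·(Λ²−1)` (`dss_amplitude_floor`, which needs the rigid delay of a DSS wave; here the timing is free).

COROLLARIES.  On `InTableClass R` (`C_A ≤ 64`): survivors have `sup‖W‖ ≥ Λ/(112(Λ²−1))` (`survivor_amplitude_floor_inTableClass`);
THE RUNG `not_survivingFwd_of_amplitude_lt` (any `R`, ANY `ε₀ > 0`, any `ν̂ ≥ 0`: no survivor with `112·B·(Λ²−1) < Λ`); and
the SLICE THEOREM `noSurvivingEternalViscBddOne_onSlice`: for every amplitude budget `B > 0`, with `ε_B = min(1, 1/(6944·B)) > 0`,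
such that for ALL `ε₀ ∈ (0, ε_B]`, all `R`, all tables of `InTableClass R`, all `ν̂ ≥ 0`: no admissible eternal solution with
`sup‖W‖ ≤ B` is forward (S₁)-surviving — K1ᵛ(1) (hence (ρ0) AND (ρ+)) restricted to `{sup‖W‖ ≤ B}`, with threshold `≍ 1/B`.
READING for ⟨20419⟩: the crux is exactly the statement that the threshold can be taken INDEPENDENT of `B`; equivalently, what
remains to exclude are survivors of renormalised amplitude `≳ 0.11/(C_Aε₀)` — TALL objects (slow clocks), uniformly in the table.
HONEST LABEL: (ρ0), (ρ+), ⟨20419⟩ and every NS statement remain OPEN; rung 0.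
-/

noncomputable section

-- the summit and its single sub-problem share the name (CONVENTIONS §1)
set_option linter.dupNamespace false

namespace Summit.NavierStokesRegularity.NavierStokesRegularity.Theorems.NoSurvivingEternalViscBddOne.SurvivorAmplitudeFloor

open Set Filter Topology MeasureTheory
open scoped RealInnerProductSpace
open Literature.Analysis.FluidPDE Literature.Analysis.FluidPDE.TaoCascade
open Summit.NavierStokesRegularity.NavierStokesRegularity.Theses.TaoLadderRungTwoBreak
open Summit.NavierStokesRegularity.NavierStokesRegularity.Theorems.NoSurvivingEternalViscBddOne.SmallAction
open Summit.NavierStokesRegularity.NavierStokesRegularity.Theorems.NoSurvivingEternalViscBddOne.WeightedGrowth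
open Summit.NavierStokesRegularity.NavierStokesRegularity.Theorems.NoSurvivingEternalViscBddOne.SurvivorEnergyBound

variable {m : ℕ} {ε₀ νh : ℝ} {α : Fin m → Fin m → Fin m → ℤ × ℤ × ℤ → ℝ} {W : ℤ → ℝ → Em m}

/-! ## §3 The amplitude floor of bounded survivors -/

/-- **THE `1/ε₀` AMPLITUDE FLOOR OF BOUNDED SURVIVORS.**  A uniformly bounded (`‖W‖ ≤ B`), forward-(S₁)-surviving admissible
eternal solution (any covariant viscosity `ν̂ ≥ 0`) of a CANCELLING table at scale ratio `1+ε₀`, `ε₀ > 0`, satisfies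
`4Λ ≤ 7·C_A·B·(Λ²−1)`, i.e. `sup‖W‖ ≥ (4/7)·Λ/(C_A((1+ε₀)⁵−1)) ≈ 0.11/(C_Aε₀)`.  Growth law (rate `(θ−1)·2C_AB/Λ`, `θ ↑ Λ²`)
against late flux starvation (`e^{σ} ≲ Λⁿ(1+ε₀)ⁿ` at the surviving event); the timing of the surviving events is free.
[cite: Tao2016AveragedNS, §4 Lemma 4.1 (4.8)–(4.10) with (4.3), the viscous equation before Thm. 4.2, §6.4; this file; tree `weightedSum_le`] -/
theorem survivor_amplitude_floor (hε : 0 < ε₀) (hW : IsEternalVisc ε₀ νh α W) (hc : IsCancellingCoeff α)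
    {B : ℝ} (hB : ∀ k σ, ‖W k σ‖ ≤ B) (hS : EternalSurvivingFwd 1 ε₀ W) :
    4 * bigLam ε₀ ≤ 7 * fluxConst α * B * (bigLam ε₀ ^ 2 - 1) := by
  have h1ε : 0 < 1 + ε₀ := by linarith
  have hΛ : 0 < bigLam ε₀ := bigLam_pos (by linarith)
  have hΛ1 : 1 < bigLam ε₀ := by unfold bigLam; exact Real.one_lt_rpow (by linarith) (by norm_num)
  have hΛ2 : 1 < bigLam ε₀ ^ 2 := by nlinarith
  have hB0 : 0 ≤ B := (norm_nonneg _).trans (hB 0 0)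
  have hC0 := fluxConst_nonneg α
  set ℓ : ℝ := Real.log (1 + ε₀) with hℓ
  have hℓ0 : 0 < ℓ := Real.log_pos (by linarith)
  have hlogΛ : Real.log (bigLam ε₀) = 5 / 2 * ℓ := by
    rw [hℓ]; unfold bigLam; rw [Real.log_rpow h1ε]
  set c : ℝ := 2 * fluxConst α * (bigLam ε₀)⁻¹ * B with hcdef
  have hc0 : 0 ≤ c := by positivity
  by_contra hlt
  push Not at hlt
  -- STEP 1: the margin at `θ = Λ²` and the choice of `θ < Λ²`
  have hval : 0 < Real.log (bigLam ε₀ ^ 2) - ℓ - 7 / 2 * ℓ * ((bigLam ε₀ ^ 2 - 1) * c) := by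
    rw [Real.log_pow, hlogΛ]
    push_cast
    have h1 : (bigLam ε₀ ^ 2 - 1) * c = 2 * (fluxConst α * B * (bigLam ε₀ ^ 2 - 1)) / bigLam ε₀ := by
      rw [hcdef]; field_simp
    have h2 : 7 / 2 * ((bigLam ε₀ ^ 2 - 1) * c) < 4 := by
      rw [h1, show 7 / 2 * (2 * (fluxConst α * B * (bigLam ε₀ ^ 2 - 1)) / bigLam ε₀)
        = (7 * fluxConst α * B * (bigLam ε₀ ^ 2 - 1)) / bigLam ε₀ by ring, div_lt_iff₀ hΛ]
      linarith
    nlinarith [mul_pos hℓ0 (sub_pos.2 h2)]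
  have hcont : ContinuousAt (fun θ => Real.log θ - ℓ - 7 / 2 * ℓ * ((θ - 1) * c)) (bigLam ε₀ ^ 2) := by
    have : bigLam ε₀ ^ 2 ≠ 0 := by positivity
    fun_prop (disch := exact this)
  have hev : ∀ᶠ θ in 𝓝 (bigLam ε₀ ^ 2), 0 < Real.log θ - ℓ - 7 / 2 * ℓ * ((θ - 1) * c) :=
    hcont.eventually (lt_mem_nhds hval)
  have hev3 : ∀ᶠ θ in 𝓝[<] (bigLam ε₀ ^ 2), θ ∈ Ioo 1 (bigLam ε₀ ^ 2) := Ioo_mem_nhdsLT hΛ2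
  have hev2 : ∀ᶠ θ in 𝓝[<] (bigLam ε₀ ^ 2),
      0 < Real.log θ - ℓ - 7 / 2 * ℓ * ((θ - 1) * c) ∧ θ ∈ Ioo 1 (bigLam ε₀ ^ 2) :=
    (hev.filter_mono nhdsWithin_le_nhds).and hev3
  obtain ⟨θ, hθpos, hθ1, hθ2⟩ := hev2.exists
  have hθ0 : 0 < θ := by linarith
  set L₁ : ℝ := Real.log θ - ℓ with hL₁
  set r : ℝ := (θ - 1) * c with hr
  have hr0 : 0 ≤ r := mul_nonneg (by linarith) hc0
  set g₀ : ℝ := L₁ - 7 / 2 * ℓ * r with hg₀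
  have hg₀0 : 0 < g₀ := hθpos
  have hL₁0 : 0 < L₁ := by nlinarith [mul_nonneg hℓ0.le hr0]
  set η : ℝ := g₀ / (7 * ℓ) with hη
  have hη0 : 0 < η := by positivity
  set ρ : ℝ := r + η with hρ
  have hρ0 : 0 < ρ := by linarith
  have hkey : 7 / 2 * ℓ * ρ < L₁ := by
    have e1 : 7 / 2 * ℓ * η = g₀ / 2 := by
      rw [hη]; field_simp
    have e2 : 7 / 2 * ℓ * ρ = 7 / 2 * ℓ * r + g₀ / 2 := by rw [hρ, mul_add, e1]
    rw [e2]; linarith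
  -- STEP 2: data of the solution
  obtain ⟨K, hK0, hK⟩ := exists_uniform_physEnergy_le hε hW hc ⟨B, hB⟩
  obtain ⟨A, hA⟩ := exists_physEnergy_le hε hW ⟨B, hB⟩ (-1)
  have hA0 : 0 ≤ A := (physEnergy_nonneg ε₀ W (-1) 0).trans (hA 0)
  have h1q : 0 < 1 - θ / bigLam ε₀ ^ 2 := by
    rw [sub_pos, div_lt_one (by positivity)]; exact hθ2
  set δ₀ : ℝ := B ^ 2 / (1 - θ / bigLam ε₀ ^ 2) with hδ₀
  have hδ₀0 : 0 ≤ δ₀ := by positivity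
  set D : ℝ := δ₀ + c * A / η + 1 with hD
  have hD0 : 0 < D := by positivity
  -- the growth law, absorbed into one exponential: `θⁿE_n(σ) ≤ D e^{ρσ}` for `σ ≥ 0`
  have hgrowth : ∀ (n : ℕ) (σ : ℝ), 0 ≤ σ → θ ^ n * physEnergy ε₀ W n σ ≤ D * Real.exp (ρ * σ) := by
    intro n σ hσ
    have h := weightedSum_le hε hW hc hB hθ1.le hθ2 hA n hσ
    simp only [sub_zero, mul_zero, Real.exp_zero, mul_one] at h
    rw [← hcdef, ← hδ₀] at h
    have hsingle : θ ^ n * physEnergy ε₀ W n σ ≤ ∑ i ∈ Finset.range (n + 1), θ ^ i * physEnergy ε₀ W i σ :=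
      Finset.single_le_sum (f := fun i : ℕ => θ ^ i * physEnergy ε₀ W i σ)
        (fun i _ => mul_nonneg (pow_nonneg hθ0.le i) (physEnergy_nonneg ε₀ W _ _))
        (Finset.mem_range.2 (Nat.lt_succ_self n))
    have he1 : 1 ≤ Real.exp (η * σ) := Real.one_le_exp (by positivity)
    have he2 : η * σ ≤ Real.exp (η * σ) := by have := Real.add_one_le_exp (η * σ); linarith
    have hlin : δ₀ + c * A * σ ≤ (δ₀ + c * A / η) * Real.exp (η * σ) := by
      have h3 : c * A * σ ≤ c * A / η * Real.exp (η * σ) := by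
        rw [div_mul_eq_mul_div, le_div_iff₀ hη0]
        have := mul_le_mul_of_nonneg_left he2 (mul_nonneg hc0 hA0)
        linarith
      have h4 : δ₀ ≤ δ₀ * Real.exp (η * σ) := le_mul_of_one_le_right hδ₀0 he1
      linarith
    have hexp : Real.exp (η * σ) * Real.exp ((θ - 1) * c * σ) = Real.exp (ρ * σ) := by
      rw [← Real.exp_add, hρ, hr]; ring_nf
    have hE0 : 0 ≤ Real.exp ((θ - 1) * c * σ) := (Real.exp_pos _).le
    calc θ ^ n * physEnergy ε₀ W n σ
        ≤ (δ₀ + c * A * σ) * Real.exp ((θ - 1) * c * σ) := hsingle.trans h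
      _ ≤ (δ₀ + c * A / η) * Real.exp (η * σ) * Real.exp ((θ - 1) * c * σ) :=
          mul_le_mul_of_nonneg_right hlin hE0
      _ = (δ₀ + c * A / η) * Real.exp (ρ * σ) := by rw [mul_assoc, hexp]
      _ ≤ D * Real.exp (ρ * σ) := mul_le_mul_of_nonneg_right (by rw [hD]; linarith) (Real.exp_pos _).le
  -- STEP 3: the asymptotic constants
  obtain ⟨c₀, hc₀, hsurv⟩ := hS
  set κ₂ : ℝ := Real.log (c₀ / (2 * D)) with hκ₂
  set Q : ℝ := bigLam ε₀ * (1 + ε₀) * Real.exp (-(L₁ / ρ)) with hQ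
  have hQ0 : 0 ≤ Q := by positivity
  have hQ1 : Q < 1 := by
    have e : Q = Real.exp (Real.log (bigLam ε₀) + ℓ - L₁ / ρ) := by
      rw [Real.exp_sub, Real.exp_add, Real.exp_log hΛ, hℓ, Real.exp_log h1ε, hQ, Real.exp_neg, div_eq_mul_inv]
      ring
    rw [e]
    refine Real.exp_lt_one_iff.2 ?_
    rw [hlogΛ]
    have : 7 / 2 * ℓ < L₁ / ρ := by rw [lt_div_iff₀ hρ0]; linarith
    linarith
  set M₀ : ℝ := 8 * fluxConst α * (K * Real.sqrt K) * Real.exp (-(κ₂ / ρ)) with hM₀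
  have hT : Tendsto (fun k : ℕ => M₀ * Q ^ k) atTop (𝓝 0) := by
    have := (tendsto_pow_atTop_nhds_zero_of_lt_one hQ0 hQ1).const_mul M₀
    simpa only [mul_zero] using this
  obtain ⟨N₁, hN₁⟩ := Filter.eventually_atTop.1 (hT.eventually (gt_mem_nhds hc₀))
  obtain ⟨N₂, hN₂⟩ := exists_nat_ge (-κ₂ / L₁)
  set N : ℕ := max (max N₁ N₂) 1 with hN
  obtain ⟨n, hnN, σs, hσs, hcle⟩ := hsurv N
  have hnN₁ : N₁ ≤ n := le_trans (le_trans (le_max_left _ _) (le_max_left _ _)) hnN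
  have hnN₂ : N₂ ≤ n := le_trans (le_trans (le_max_right _ _) (le_max_left _ _)) hnN
  have hn1 : 1 ≤ n := le_trans (le_max_right _ _) hnN
  have hσs0 : 0 ≤ σs := le_trans (Nat.cast_nonneg N) hσs
  -- survival in energy form: `c₀ ≤ (1+ε₀)ⁿ E_n(σ⋆)`
  have hEs : c₀ ≤ (1 + ε₀) ^ n * physEnergy ε₀ W n σs := by
    rw [← wtEnergy_eq hε W n σs]; exact hcle
  have hpow : 0 < (1 + ε₀) ^ n := by positivity
  have hθn : 0 < θ ^ n := pow_pos hθ0 n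
  -- the growth time `σ_m` of shell `n`
  set σm : ℝ := ((n : ℝ) * L₁ + κ₂) / ρ with hσm
  have hnum : 0 ≤ (n : ℝ) * L₁ + κ₂ := by
    have h1 : -κ₂ / L₁ ≤ (n : ℝ) := hN₂.trans (by exact_mod_cast hnN₂)
    rw [div_le_iff₀ hL₁0] at h1
    linarith
  have hσm0 : 0 ≤ σm := div_nonneg hnum hρ0.le
  have hexpσm : D * Real.exp (ρ * σm) = θ ^ n * (c₀ / 2 / (1 + ε₀) ^ n) := by
    have e1 : ρ * σm = (n : ℝ) * L₁ + κ₂ := by rw [hσm]; field_simp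
    have e2 : Real.exp L₁ = θ / (1 + ε₀) := by
      rw [hL₁, Real.exp_sub, Real.exp_log hθ0, hℓ, Real.exp_log h1ε]
    have e3 : Real.exp κ₂ = c₀ / (2 * D) := by rw [hκ₂, Real.exp_log (by positivity)]
    rw [e1, Real.exp_add, Real.exp_nat_mul, e2, e3, div_pow]
    field_simp
  have hearly : ∀ σ, 0 ≤ σ → σ ≤ σm → physEnergy ε₀ W n σ ≤ c₀ / 2 / (1 + ε₀) ^ n := by
    intro σ h0 hm
    have h1 := hgrowth n σ h0
    have h2 : D * Real.exp (ρ * σ) ≤ D * Real.exp (ρ * σm) :=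
      mul_le_mul_of_nonneg_left (Real.exp_le_exp.2 (mul_le_mul_of_nonneg_left hm hρ0.le)) hD0.le
    rw [hexpσm] at h2
    exact le_of_mul_le_mul_left (h1.trans h2) hθn
  rcases le_or_gt σs σm with hcase | hcase
  · -- the surviving event happens before the growth law allows it
    have h1 := hearly σs hσs0 hcase
    have h2 : (1 + ε₀) ^ n * physEnergy ε₀ W n σs ≤ c₀ / 2 := by
      calc (1 + ε₀) ^ n * physEnergy ε₀ W n σs ≤ (1 + ε₀) ^ n * (c₀ / 2 / (1 + ε₀) ^ n) :=
            mul_le_mul_of_nonneg_left h1 hpow.le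
        _ = c₀ / 2 := by field_simp
    linarith
  · -- the surviving event happens after `σ_m`: the bond fluxes are already starved
    have h1 := hearly σm hσm0 le_rfl
    have h2 := physEnergy_late_le hε hW hc hK0.le hK hn1 hcase.le
    have hexpm : Real.exp (-σm) = Real.exp (-(κ₂ / ρ)) * Real.exp (-(L₁ / ρ)) ^ n := by
      rw [← Real.exp_nat_mul, ← Real.exp_add, hσm]
      congr 1
      field_simp
      ring
    have hprod : bigLam ε₀ ^ n * (1 + ε₀) ^ n * Real.exp (-σm) = Real.exp (-(κ₂ / ρ)) * Q ^ n := by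
      rw [hexpm, hQ, mul_pow, mul_pow]; ring
    have h3 := hN₁ n hnN₁
    have h4 : (1 + ε₀) ^ n * physEnergy ε₀ W n σs
        ≤ c₀ / 2 + 4 * fluxConst α * (K * Real.sqrt K) * (Real.exp (-(κ₂ / ρ)) * Q ^ n) := by
      have h5 : physEnergy ε₀ W n σs
          ≤ c₀ / 2 / (1 + ε₀) ^ n + 4 * fluxConst α * bigLam ε₀ ^ n * (K * Real.sqrt K) * Real.exp (-σm) := by
        linarith
      calc (1 + ε₀) ^ n * physEnergy ε₀ W n σs
          ≤ (1 + ε₀) ^ n * (c₀ / 2 / (1 + ε₀) ^ n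
              + 4 * fluxConst α * bigLam ε₀ ^ n * (K * Real.sqrt K) * Real.exp (-σm)) :=
            mul_le_mul_of_nonneg_left h5 hpow.le
        _ = c₀ / 2 + 4 * fluxConst α * (K * Real.sqrt K)
              * (bigLam ε₀ ^ n * (1 + ε₀) ^ n * Real.exp (-σm)) := by
            field_simp
        _ = _ := by rw [hprod]
    have h6 : M₀ * Q ^ n = 2 * (4 * fluxConst α * (K * Real.sqrt K) * (Real.exp (-(κ₂ / ρ)) * Q ^ n)) := by
      rw [hM₀]; ring
    linarith

/-! ## §4 Corollaries on the comparable class: the rung and the slice theorem -/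

/-- **The floor in numbers on a table of `InTableClass R`** (`C_A ≤ 64`): every uniformly bounded forward-(S₁)-surviving
admissible eternal solution (any `ν̂ ≥ 0`) has `Λ ≤ 112·sup‖W‖·(Λ²−1)`, i.e. `sup‖W‖ ≥ Λ/(112((1+ε₀)⁵−1)) ≈ 1/(560ε₀)`.
[cite: Tao2016AveragedNS, §4 Thm. 4.2 (statement shape), Lemma 4.1 (4.8)–(4.10), §6.4; this file; tree `fluxConst_le_64`] -/
theorem survivor_amplitude_floor_inTableClass {R : ℝ} (hε : 0 < ε₀) {α : Fin 4 → Fin 4 → Fin 4 → ℤ × ℤ × ℤ → ℝ}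
    (hα : InTableClass R α) {W : ℤ → ℝ → Em 4} (hW : IsEternalVisc ε₀ νh α W)
    {B : ℝ} (hB : ∀ k σ, ‖W k σ‖ ≤ B) (hS : EternalSurvivingFwd 1 ε₀ W) :
    bigLam ε₀ ≤ 112 * B * (bigLam ε₀ ^ 2 - 1) := by
  have h := survivor_amplitude_floor hε hW hα.2.1 hB hS
  have hC := fluxConst_le_64 hα
  have hB0 : 0 ≤ B := (norm_nonneg _).trans (hB 0 0)
  have hΛ1 : 1 < bigLam ε₀ := by unfold bigLam; exact Real.one_lt_rpow (by linarith) (by norm_num)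
  have hΛ2 : 0 ≤ bigLam ε₀ ^ 2 - 1 := by nlinarith
  have h2 : 7 * fluxConst α * B * (bigLam ε₀ ^ 2 - 1) ≤ 7 * 64 * B * (bigLam ε₀ ^ 2 - 1) := by
    have := mul_le_mul_of_nonneg_right (mul_le_mul_of_nonneg_right hC hB0) hΛ2
    nlinarith
  nlinarith

/-- **THE RUNG (amplitude slice of K1ᵛ(1)), by name over the crux's binders.**  For EVERY spread `R`, EVERY `ε₀ > 0` and every
covariant viscosity `ν̂ ≥ 0`: no table of `InTableClass R` carries a forward-(S₁)-surviving admissible eternal solution with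
`sup‖W‖ ≤ B` and `112·B·(Λ²−1) < Λ`.  Covers both split children at once ((ρ0) `ν̂ = 0`, (ρ+) `ν̂ > 0`); as `ε₀ → 0` the excluded
amplitude range `B < Λ/(112(Λ²−1)) ≈ 1/(560ε₀)` exhausts every bounded set.
[cite: Tao2016AveragedNS, §4 Thm. 4.2 (statement shape), Lemma 4.1 (4.8)–(4.10), §6.4; this file] -/
theorem not_survivingFwd_of_amplitude_lt {R : ℝ} (hε : 0 < ε₀) {α : Fin 4 → Fin 4 → Fin 4 → ℤ × ℤ × ℤ → ℝ}
    (hα : InTableClass R α) {W : ℤ → ℝ → Em 4} (hW : IsEternalVisc ε₀ νh α W)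
    {B : ℝ} (hB : ∀ k σ, ‖W k σ‖ ≤ B) (hsmall : 112 * B * (bigLam ε₀ ^ 2 - 1) < bigLam ε₀) :
    ¬ EternalSurvivingFwd 1 ε₀ W := fun hS =>
  absurd (survivor_amplitude_floor_inTableClass hε hα hW hB hS) (not_le.2 hsmall)

/-- `(1+ε)⁵ − 1 ≤ 31ε` on `[0,1]`. [folklore] -/
private theorem pow_five_sub_one_le {ε : ℝ} (h0 : 0 ≤ ε) (h1 : ε ≤ 1) : (1 + ε) ^ 5 - 1 ≤ 31 * ε := by
  have h2 : ε ^ 2 ≤ ε := by nlinarith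
  have h3 : ε ^ 3 ≤ ε := by nlinarith
  have h4 : ε ^ 4 ≤ ε := by nlinarith
  have h5 : ε ^ 5 ≤ ε := by nlinarith
  nlinarith

/-- **THE SLICE THEOREM: K1ᵛ(1) HOLDS ON EVERY BOUNDED-AMPLITUDE SLICE, threshold `ε_B ≍ 1/B`.**  For every amplitude budget
`B > 0` put `ε_B := min 1 (1/(6944·B))`.  Then for ALL `ε₀ ∈ (0, ε_B]`, ALL spreads `R`, all tables of `InTableClass R`, all
`ν̂ ≥ 0`: no admissible eternal solution with `sup‖W‖ ≤ B` is forward (S₁)-surviving — the deciding crux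
`NoSurvivingEternalViscBddOne` (hence (ρ0) `NoSurvivingEternalBddOne` AND (ρ+) `NoLoudLadderOne`) restricted to `{sup‖W‖ ≤ B}`,
uniformly in `R`.  The crux ⟨20419⟩ is exactly the assertion that the threshold can be chosen independently of `B`.
[cite: Tao2016AveragedNS, §4 Thm. 4.2 (statement shape), Lemma 4.1 (4.8)–(4.10), §6.4; this file] -/
theorem noSurvivingEternalViscBddOne_onSlice {B : ℝ} (hBpos : 0 < B) :
    ∀ ε₀ : ℝ, 0 < ε₀ → ε₀ ≤ min 1 (1 / (6944 * B)) →
      ∀ (R : ℝ) (α : Fin 4 → Fin 4 → Fin 4 → ℤ × ℤ × ℤ → ℝ), InTableClass R α →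
        ∀ (νh : ℝ) (W : ℤ → ℝ → Em 4), IsEternalVisc ε₀ νh α W → (∀ k σ, ‖W k σ‖ ≤ B) →
          ¬ EternalSurvivingFwd 1 ε₀ W := by
  intro ε₀ hε hle R α hα νh W hW hB
  have hε1 : ε₀ ≤ 1 := hle.trans (min_le_left _ _)
  have hεB : ε₀ ≤ 1 / (6944 * B) := hle.trans (min_le_right _ _)
  have hΛ1 : 1 ≤ bigLam ε₀ := one_le_bigLam hε.le
  refine not_survivingFwd_of_amplitude_lt hε hα hW hB ?_
  rw [bigLam_sq hε.le]
  have h1 : (1 + ε₀) ^ 5 - 1 ≤ 31 * ε₀ := pow_five_sub_one_le hε.le hε1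
  have h2 : 112 * B * ((1 + ε₀) ^ 5 - 1) ≤ 112 * B * (31 * ε₀) := mul_le_mul_of_nonneg_left h1 (by positivity)
  have h3 : 6944 * B * ε₀ ≤ 1 := by
    rw [le_div_iff₀ (by positivity)] at hεB
    linarith
  nlinarith

/-- **The slice theorem in the crux's own vocabulary** (`UniformBound` with an explicit budget): for `0 < ε₀ ≤ min 1 (1/(6944B))`
the predicate `NoSurvivingEternalViscBdd R 1`'s conclusion holds for every admissible eternal solution of amplitude `≤ B`, on
every table of `InTableClass R`, every `R`, every `ν̂ ≥ 0` — in particular for the INVISCID ones (`IsEternal`, child (ρ0)).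
[cite: Tao2016AveragedNS, §4 Thm. 4.2 (statement shape), §6.4; this file; tree `IsEternal.isEternalVisc`] -/
theorem noSurvivingEternalBddOne_onSlice {B : ℝ} (hBpos : 0 < B) :
    ∀ ε₀ : ℝ, 0 < ε₀ → ε₀ ≤ min 1 (1 / (6944 * B)) →
      ∀ (R : ℝ) (α : Fin 4 → Fin 4 → Fin 4 → ℤ × ℤ × ℤ → ℝ), InTableClass R α →
        ∀ W : ℤ → ℝ → Em 4, IsEternal ε₀ α W → (∀ k σ, ‖W k σ‖ ≤ B) →
          ¬ EternalSurvivingFwd 1 ε₀ W :=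
  fun ε₀ hε hle R α hα W hW hB =>
    noSurvivingEternalViscBddOne_onSlice hBpos ε₀ hε hle R α hα 0 W hW.isEternalVisc hB

end Summit.NavierStokesRegularity.NavierStokesRegularity.Theorems.NoSurvivingEternalViscBddOne.SurvivorAmplitudeFloor

end
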